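import Summits.ResolutionOfSingularities.ResolutionOfSingularities.Theorems.FrobeniusLadderFRationalResolutionGaloisSymmetrizedPiece
import Summits.ResolutionOfSingularities.ResolutionOfSingularities.Theorems.FrobeniusLadderFRationalResolutionBlowupAbsorbsCartier
import Summits.ResolutionOfSingularities.ResolutionOfSingularities.Theorems.FrobeniusLadderFRationalResolutionBlowupChartCartier
import Mathlib.RingTheory.Localization.Away.Basic
import HarnessLib

/-!
# Crux `FrobeniusLadder.FRationalResolution` (stmt-ResolutionOfSingularities-15317), line `redirect`,
# stub `stub_diagonalizableQuotientResolution` — the SYMMETRIZED PIECE HAS REGULAR BLOW-UP as soon as the twists of the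
# original piece are principal on the Rees charts of its blow-up (one-stop form of the Galois route's remaining obligation)

Assembly of `…GaloisSymmetrizedPiece` (hD by construction), `…BlowupChartCartier` (chartwise Cartier criterion) and
`…BlowupAbsorbsCartier` (a blow-up absorbs the centres it makes Cartier). Data: `K'/K` finite, `𝔔' ⊆ B' = B ⊗_K K'`, a piece
`I₁` with `𝔔'ⁿ ⊆ I₁ ⊆ 𝔔'`, an element `h` with `Bl_{I₁ B'_h}` regular (the output of `…GaloisUpstairsPiece`), a reduction
`(xᵢ)` of `I₁ B'_h`, and — THE HYPOTHESIS TO BE DISCHARGED BY THE NEXT SEAT — for every `σ` in the decomposition group of `𝔔'`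
and every chart `i`, a nonzerodivisor generating the extension of the twist `((1 ⊗ σ) I₁) B'_h` to the Rees chart ring
`(B'_h[I₁t])_{(xᵢ t)}`. Conclusion: the symmetrized piece `I = ∏_{σ ∈ D} (1 ⊗ σ)(I₁)` is `𝔔'`-primary, decomposition-stable,
and `Bl_{I B'_h}` is regular — i.e. `(I, m, hD, hreg)` of `…GaloisBaseChangeRegular.hloc_of_decomposition_stable_piece'` with
`g = h` (given `h ∉ 𝔔'`).

* **`symmetrizedPiece_isRegular_affineBlowup`** — the statement above.

Honest label: plumbing toward ONE leaf stub (no stub, crux or summit closed). No definitions, no named facts, no sorry.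
[cite: StacksProject, Tag 080A; Tag 0804; Tag 09EB]
-/

noncomputable section

-- single-problem summit: the doubled namespace component is forced
set_option linter.dupNamespace false

open CategoryTheory AlgebraicGeometry HomogeneousLocalization
open scoped TensorProduct
open Literature.AlgebraicGeometry.Resolution

namespace Summit.ResolutionOfSingularities.ResolutionOfSingularities.Theorems.FRationalResolution.GaloisSymmetrizedPieceRegular

/-- **The symmetrized piece has regular blow-up when the twists are principal on the Rees charts.** See the module
docstring. [cite: StacksProject, Tag 080A; Tag 0804; Tag 09EB] -/
theorem symmetrizedPiece_isRegular_affineBlowup {K B K' : Type} [Field K] [CommRing B] [Algebra K B] [Field K']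
    [Algebra K K'] [FiniteDimensional K K'] (𝔔' : Ideal (B ⊗[K] K')) (I₁ : Ideal (B ⊗[K] K')) {n : ℕ}
    (hn : 𝔔' ^ n ≤ I₁) (h₁ : I₁ ≤ 𝔔') (h : B ⊗[K] K')
    (hreg₁ : Scheme.IsRegular (affineBlowup (I₁.map (algebraMap (B ⊗[K] K') (Localization.Away h)))))
    {ι : Type*} (x : ι → Localization.Away h)
    (hxI : ∀ i, x i ∈ I₁.map (algebraMap (B ⊗[K] K') (Localization.Away h))) {N : ℕ}
    (hI : (I₁.map (algebraMap (B ⊗[K] K') (Localization.Away h))) ^ (N + 1) ≤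
      Ideal.span (Set.range x) * (I₁.map (algebraMap (B ⊗[K] K') (Localization.Away h))) ^ N)
    (htw : ∀ σ : K' ≃ₐ[K] K',
      𝔔'.map (Algebra.TensorProduct.map (AlgHom.id B B) (σ : K' →ₐ[K] K')) = 𝔔' → ∀ i,
      ∃ ℓ : Away (reesGrading (I₁.map (algebraMap (B ⊗[K] K') (Localization.Away h)))) (reesT (x i) (hxI i)),
        ℓ ∈ nonZeroDivisors _ ∧
        ((I₁.map (Algebra.TensorProduct.map (AlgHom.id B B) (σ : K' →ₐ[K] K'))).map
            (algebraMap (B ⊗[K] K') (Localization.Away h))).map (reesChartBase (x i) (hxI i)) = Ideal.span {ℓ}) :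
    ∃ (I : Ideal (B ⊗[K] K')) (m : ℕ), 𝔔' ^ m ≤ I ∧ I ≤ 𝔔' ∧ I ≤ I₁ ∧
      (∀ τ : K' ≃ₐ[K] K', 𝔔'.map (Algebra.TensorProduct.map (AlgHom.id B B) (τ : K' →ₐ[K] K')) = 𝔔' →
        I.map (Algebra.TensorProduct.map (AlgHom.id B B) (τ : K' →ₐ[K] K')) ≤ I) ∧
      Scheme.IsRegular (affineBlowup (I.map (algebraMap (B ⊗[K] K') (Localization.Away h)))) := by
  classical
  obtain ⟨D, m, hmemD, hQm, hleI₁, hleQ, hstab⟩ :=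
    GaloisSymmetrizedPiece.exists_decomposition_stable_piece 𝔔' I₁ hn h₁
  set tw : (K' ≃ₐ[K] K') → Ideal (B ⊗[K] K') :=
    fun σ => I₁.map (Algebra.TensorProduct.map (AlgHom.id B B) (σ : K' →ₐ[K] K')) with htwdef
  refine ⟨∏ σ ∈ D, tw σ, m, hQm, hleQ, hleI₁, fun τ hτ => (hstab τ hτ).le, ?_⟩
  -- the localized symmetrized piece is the product of the localized twists
  set loc := algebraMap (B ⊗[K] K') (Localization.Away h) with hloc
  have hprod : (∏ σ ∈ D, tw σ).map loc = ∏ σ ∈ D, (tw σ).map loc := by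
    have := map_prod (Ideal.mapHom loc) tw D
    simpa only [Ideal.mapHom_apply] using this
  rw [hprod]
  -- the factor at `σ = 1` is `I₁ B'_h`, whose blow-up is regular; the other twists are Cartier on it chartwise
  have hone : (1 : K' ≃ₐ[K] K') ∈ D := by
    rw [hmemD, GaloisSymmetrizedPiece.twist_one]
    exact Ideal.map_id _
  have htw1 : (tw 1).map loc = I₁.map loc := by
    simp only [htwdef, GaloisSymmetrizedPiece.twist_one]
    exact congrArg (Ideal.map loc) (Ideal.map_id _)
  refine BlowupAbsorbsCartier.affineBlowup_prod_isRegular_of_isEffectiveCartier' D (fun σ => (tw σ).map loc) hone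
    (by rw [htw1]; exact hreg₁) fun σ hσ => ?_
  rw [htw1]
  exact BlowupChartCartier.affineBlowup.isEffectiveCartier_comap_idealSheaf_of_charts x hxI hI _
    (htw σ ((hmemD σ).mp hσ))

end Summit.ResolutionOfSingularities.ResolutionOfSingularities.Theorems.FRationalResolution.GaloisSymmetrizedPieceRegular

end
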